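import Literature.NumberTheory.EllipticCurves.PAdicLFunctionTameMultEulerFactorProofs
import Literature.NumberTheory.EllipticCurves.PAdicLFunctionTameMultBirchProofs
import Literature.NumberTheory.EllipticCurves.PAdicLFunctionTameMultIntegralityAtTwoProofs
import Literature.NumberTheory.EllipticCurves.PAdicLFunctionQuadraticTwistBirchPeriodProofs
import Literature.NumberTheory.EllipticCurves.IsogenyFrobeniusTraceProofs
import HarnessLib

/-!
# Matsuno 2000, proof of Thm. 3.1 (= Lemmas 3.2 + 3.3 + Birch) READ AT a MULTIPLICATIVE `2`: the mod-`2` congruence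
# between THE `2`-adic `L`-function of a quadratic twist `E^{(d)}` and `L₂(E)·∏_{ℓ∣d}𝒫_ℓ`, `E` multiplicative at `2`
# (PROOFS ONLY: no `def`, no named fact)

Companion of `PAdicLFunctionTameMult` (cell bsd-2adic, seat conv-1 GEN 13, road «hKan-mult»); the one-term twin of
`PAdicLFunctionTameDepletionCongruenceAtTwoProofs` (+ `…AutoProofs`) and `PAdicLFunctionQuadraticTwistCongruenceAtTwoProofs`.
For `E = W/ℚ` globally minimal, MULTIPLICATIVE at `2` (split or non-split; `a₂ = a₂(E) ∈ {1, −1}`), `f` its newform, and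
`L₂(f, a₂, ·)` the one-term transforms (`padicLFunctionTameMult`; at `m = 1` THE package function, `PAdicLFunctionTameMultProofs` §4):

* §0 `exists_ratPlusSymbol_ne_zero` — a rational newform has SOME nonzero plus symbol (`Ω⁺_f > 0` and `Λ_f` is generated by cusp
  symbols), used to see that Birch's constant is nonzero without Rohrlich's theorem at a prime dividing the level;
* §1 `exists_iwasawa_padicLFunctionTameMult_one_congr_two` — DEPLETION: for a finite set `S₀` of odd places of good reduction,
  `m = ∏ ℓ_v`, there are `L_W, G₁ ∈ Λ`, `u ∈ Λˣ` with `ι L_W = L₂(f,a₂,𝟙_1)`, `ι G₁ = L₂(f,a₂,𝟙_m)`, `G₁ ≡ u·L_W·∏𝒫_v (mod 2)`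
  (Lemma 3.3 iterated, `iwasawaToPowerSeries_prod_tameEulerFactor_mul_mult`, and `𝒫_ℓ ≡ −(1+T)^{f_ℓ} h_ℓ`,
  `map_toZMod_eulerFactorElement_two_eq`);
* §2 `exists_iwasawa_padicLFunctionTameMult_congr_two` — with the CHARACTER half (`exists_iwasawa_pair_map_toZMod_eq_two_mult`):
  `ι G = L₂(f,a₂,χ)`, `G ≡ u·L_W·∏𝒫_v (mod 2)` for `χ` even quadratic mod `m`;
* §3 **`exists_iwasawa_twist_congr_two_mult`** — with BIRCH (`exists_ratPlusSymbol_twist_eq_sum`,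
  `padicLFunctionTameMult_twist_eq_of_birch`): for `d > 0`, `d ≡ 1 (mod 4)` squarefree and prime to `N_E`, `A` a model of `E^{(d)}`
  (newform `f_A`, `a₂(A) = (2/d)·a₂(E)`), and `S₀` the places over the primes of `d`: there are `L_W, L_A' ∈ Λ`, `c_A ∈ ℚˣ`, `v ∈ Λˣ`
  with `ι L_W = L₂(f_W, a₂(E), 𝟙_1)`, `ι L_A' = C(c_A)·L₂(f_A, a₂(A), 𝟙_1)` and `L_A' ≡ v·L_W·∏_{v∈S₀}𝒫_v (mod 2Λ)` — the input of the
  cell's `mu_eq_zero_and_lam_eq_add_kidaShift_of_congruence` (`TwoAdicConverseKidaAnalyticOfCongruence`).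

References: K. Matsuno, J. Number Theory 84 (2000), Thm. 3.1, Lemmas 3.2–3.3 (pp. 86–88) [Matsuno2000]; B. Mazur, J. Tate,
J. Teitelbaum, Invent. Math. 84 (1986), §I.8, §I.10 [MazurTateTeitelbaum1986Invent]; R. Greenberg, V. Vatsal, Invent. Math. 142
(2000), §1 (8)–(9), Prop. (2.4) [GreenbergVatsal2000].
-/

noncomputable section

open scoped Classical MatrixGroups ModularForm NumberTheorySymbols

open NumberField IsDedekindDomain WeierstrassCurve CongruenceSubgroup PowerSeries
  Literature.NumberTheory.EllipticCurves.ModularForms Literature.NumberTheory.EllipticCurves.GreenbergVatsal2000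

namespace Literature.NumberTheory.EllipticCurves

/-! ### §0. A rational newform has a nonzero plus symbol -/

section PlusSymbol

variable {N : ℕ} [NeZero N] {f : CuspForm (Gamma0 N) 2}

/-- **Some `[x]⁺_f` is nonzero** for a normalised newform with rational coefficients: otherwise every `re{∞, r}_f` vanishes
(`plusSymbol_eq_re_holds`, `Ω⁺_f > 0`), hence every cusp symbol has real part `0`, so `re Λ_f = 0`; but
`re Λ_f = ℤ·(Ω⁺_f/2)` with `Ω⁺_f > 0` (`IsNewform0.plusPeriod_pos_holds`). [cite: MazurTateTeitelbaum1986Invent, §I.8]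
[cite: CremonaAlgorithms1997, §2.8] -/
theorem exists_ratPlusSymbol_ne_zero (hf : IsNewform0 f) (hQ : coeffField f = ⊥) : ∃ x : ℚ, ratPlusSymbol f x ≠ 0 := by
  by_contra h
  simp only [not_exists, not_not] at h
  have hpos : 0 < plusPeriod f := IsNewform0.plusPeriod_pos_holds hf hQ
  obtain ⟨hre, -⟩ := realPeriods_eq_zmultiples_of_plusPeriod_ne_zero f hpos.ne'
  have hrat : ∀ r : ℚ, (ratPlusSymbol f r : ℝ) = normalizedPlusSymbol f r := ratCast_ratPlusSymbol_holds hf hQ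
  have hreal : ∀ n, (cuspCoeff f n).im = 0 := cuspCoeff_im_eq_zero_of_coeffField_eq_bot hQ
  have hms : ∀ r : ℚ, (modularSymbol f r).re = 0 := by
    intro r
    have h1 : normalizedPlusSymbol f r = 0 := by rw [← hrat, h r, Rat.cast_zero]
    rw [normalizedPlusSymbol, plusSymbol_eq_re_holds f hreal r, Complex.ofReal_re, div_eq_zero_iff] at h1
    exact h1.resolve_right hpos.ne'
  have hΛ : ∀ z ∈ periodLattice f, z.re = 0 := by
    intro z hz
    induction hz using AddSubgroup.closure_induction with
    | mem x hx =>
      obtain ⟨γ, rfl⟩ := hx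
      unfold cuspSymbol
      split_ifs
      · simp
      · exact hms _
    | zero => simp
    | add x y _ _ hx hy => rw [Complex.add_re, hx, hy, add_zero]
    | neg x _ hx => rw [Complex.neg_re, hx, neg_zero]
  have hmem : plusPeriod f / 2 ∈ realPeriods f := by
    rw [hre]; exact AddSubgroup.mem_zmultiples _
  obtain ⟨z, hz, hzre⟩ := AddSubgroup.mem_map.mp hmem
  have h0 : plusPeriod f / 2 = 0 := by
    rw [← hzre]
    exact hΛ z hz
  linarith

end PlusSymbol

/-! ### §1–§2. Depletion and character congruences at a multiplicative `2` -/

section DepletionAtTwo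

variable {N : ℕ} [NeZero N] {f : CuspForm (Gamma0 N) 2}
  {W : WeierstrassCurve ℚ} [W.IsElliptic] [W.IsGloballyMinimal]

/-- Distinct finite places of `ℚ` lie over distinct primes; private helper. [folklore] -/
private theorem natGenerator_injective_rat'' :
    Function.Injective (Rat.HeightOneSpectrum.natGenerator (R := 𝓞 ℚ)) := fun _ _ h ↦
  (Rat.HeightOneSpectrum.primesEquiv (R := 𝓞 ℚ)).injective (Subtype.ext h)

/-- `−(1+T)^{c}` is a unit of `Λ`; private helper. [folklore] -/
private theorem isUnit_neg_binomialSeries' {p : ℕ} [Fact p.Prime] (c : ℤ_[p]) :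
    IsUnit (-PowerSeries.binomialSeries ℤ_[p] c) := by
  refine (isUnit_iff_exists_inv.mpr ⟨PowerSeries.binomialSeries ℤ_[p] (-c), ?_⟩).neg
  rw [← PowerSeries.binomialSeries_add, add_neg_cancel, PowerSeries.binomialSeries_zero]

omit [W.IsElliptic] [W.IsGloballyMinimal] in
/-- For the newform of a curve multiplicative at `2`: `2 ∣ N` and `a₂ ∈ {1, −1}`, so `‖a₂‖₂ = 1`; private helper. [folklore] -/
private theorem two_dvd_and_norm_eq_one_of_mult (hf : IsNewformOf W f) (hmult : W.HasMultiplicativeReductionAtPrime 2)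
    {ap : ℤ} (hap : cuspCoeff f 2 = ap) : 2 ∣ N ∧ ‖((ap : ℤ) : ℚ_[2])‖ = 1 := by
  obtain ⟨h2N, -, ha₂, -⟩ := two_dvd_level_and_norm_ratPlusSymbol_half_le_one_of_mult_two hf hmult
  refine ⟨h2N, ?_⟩
  rcases ha₂ with h | h
  · have : ap = 1 := by exact_mod_cast (hap.symm.trans h)
    subst this; simp
  · have : ap = -1 := by exact_mod_cast (hap.symm.trans h)
    subst this; simp

/-- **The `m`-depleted one-term `2`-adic `L`-function vs `L₂(E)·∏ 𝒫_ℓ`, modulo `2`, at a MULTIPLICATIVE `2`.** For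
`E = W/ℚ` globally minimal, multiplicative at `2`, `f` its newform (`a₂(f) = a₂`), `S₀` a finite set of ODD places of GOOD
reduction and `m = ∏_{v∈S₀} ℓ_v`: there are `L_W, G₁ ∈ ℤ₂⟦T⟧`, `u ∈ ℤ₂⟦T⟧ˣ` with `ι L_W = L₂(f,a₂,𝟙_1)`, `ι G₁ = L₂(f,a₂,𝟙_m)`
and `G₁ mod 2 = (u·L_W·∏_{v∈S₀}𝒫_v) mod 2` — Matsuno's Lemma 3.3 iterated and `𝒫_ℓ ≡ −(1+T)^{f_ℓ} h_ℓ (mod 2)`.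
[cite: Matsuno2000, Lemma 3.3 and proof of Theorem 3.1 (pp. 87–88)] [cite: GreenbergVatsal2000, §1 p. 9 (display (8)) and §2 Prop. (2.4)] -/
theorem exists_iwasawa_padicLFunctionTameMult_one_congr_two (hf : IsNewformOf W f)
    (hmult : W.HasMultiplicativeReductionAtPrime 2) {ap : ℤ} (hap : cuspCoeff f 2 = ap)
    (S₀ : Finset (HeightOneSpectrum (𝓞 ℚ)))
    (hS2 : ∀ v ∈ S₀, Rat.HeightOneSpectrum.natGenerator v ≠ 2) (hgood : ∀ v ∈ S₀, W.HasGoodReductionAt v)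
    {m : ℕ} [NeZero m] (hm : m = ∏ v ∈ S₀, Rat.HeightOneSpectrum.natGenerator v) :
    ∃ (LW G₁ : IwasawaAlgebra 2) (u : (IwasawaAlgebra 2)ˣ),
      iwasawaToPowerSeries 2 LW = padicLFunctionTameMult f 1 (ap : ℚ_[2]) (1 : DirichletCharacter ℚ_[2] 1) ∧
      iwasawaToPowerSeries 2 G₁ = padicLFunctionTameMult f m (ap : ℚ_[2]) (1 : DirichletCharacter ℚ_[2] m) ∧
      PowerSeries.map (PadicInt.toZMod (p := 2)) G₁ =
        PowerSeries.map (PadicInt.toZMod (p := 2)) ((u : IwasawaAlgebra 2) * LW * eulerFactorProduct W 2 S₀) := by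
  obtain ⟨hpN, hαu⟩ := two_dvd_and_norm_eq_one_of_mult hf hmult hap
  have h1even : (1 : DirichletCharacter ℚ_[2] 1).Even := by
    show (1 : DirichletCharacter ℚ_[2] 1) (-1) = 1
    rw [Subsingleton.elim (-1 : ZMod 1) 1, map_one]
  obtain ⟨LW, hLW⟩ := exists_iwasawaToPowerSeries_eq_padicLFunctionTameMult_two (m := 1) hf hmult
    (Nat.coprime_one_left 2) (Nat.coprime_one_left N) hap 1 h1even
  have hprime : ∀ v : HeightOneSpectrum (𝓞 ℚ), (Rat.HeightOneSpectrum.natGenerator v).Prime := fun v ↦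
    (Rat.HeightOneSpectrum.primesEquiv v).2
  have hcop : ∀ v ∈ S₀, (Rat.HeightOneSpectrum.natGenerator v).Coprime 2 := fun v hv ↦
    (Nat.coprime_primes (hprime v) Nat.prime_two).mpr (hS2 v hv)
  have hgoodp : ∀ v ∈ S₀, (haveI : Fact (Rat.HeightOneSpectrum.natGenerator v).Prime := ⟨hprime v⟩;
      W.HasGoodReductionAtPrime (Rat.HeightOneSpectrum.natGenerator v)) := fun v hv ↦
    (hasGoodReductionAtPrime_iff_hasGoodReductionAt_ringOfIntegers v W).mpr (hgood v hv)
  set teich : ℕ → rootsOfUnity (torsionOrder 2) ℤ_[2] := fun ℓ ↦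
    if h : ℓ.Coprime 2 then Classical.choose (exists_teichmuller_frobeniusExponent 2 h) else 1 with hteich
  have hc : ∀ ℓ ∈ S₀.image Rat.HeightOneSpectrum.natGenerator, ∀ n : ℕ,
      PadicInt.toZModPow (n + cyclotomicExponent 2) ((teich ℓ : ℤ_[2]ˣ) : ℤ_[2]) *
        (cyclotomicGenerator 2 : ZMod (2 ^ (n + cyclotomicExponent 2))) ^
          (PadicInt.toZModPow n ((fun ℓ : ℕ ↦ frobeniusExponent 2 (ℓ : ℤ_[2])) ℓ)).val =
          (ℓ : ZMod (2 ^ (n + cyclotomicExponent 2))) := by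
    intro ℓ hℓ n
    obtain ⟨v, hv, rfl⟩ := Finset.mem_image.mp hℓ
    have h := hcop v hv
    simp only [hteich, dif_pos h]
    exact Classical.choose_spec (exists_teichmuller_frobeniusExponent 2 h) n
  have hS : ∀ ℓ ∈ S₀.image Rat.HeightOneSpectrum.natGenerator, ℓ.Prime ∧ ¬ ℓ ∣ N ∧ ℓ.Coprime 2 := by
    intro ℓ hℓ
    obtain ⟨v, hv, rfl⟩ := Finset.mem_image.mp hℓ
    haveI : Fact (Rat.HeightOneSpectrum.natGenerator v).Prime := ⟨hprime v⟩
    exact ⟨hprime v, not_dvd_level_of_isNewformOf hf (hgoodp v hv), hcop v hv⟩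
  have ha : ∀ ℓ ∈ S₀.image Rat.HeightOneSpectrum.natGenerator, cuspCoeff f ℓ = ((W.frobeniusTrace ℓ : ℤ) : ℂ) := by
    intro ℓ hℓ
    obtain ⟨v, hv, rfl⟩ := Finset.mem_image.mp hℓ
    haveI : Fact (Rat.HeightOneSpectrum.natGenerator v).Prime := ⟨hprime v⟩
    exact cuspCoeff_eq_frobeniusTrace_of_isNewformOf_holds hf (hgoodp v hv)
  have hinj : ∀ v ∈ S₀, ∀ w ∈ S₀,
      Rat.HeightOneSpectrum.natGenerator v = Rat.HeightOneSpectrum.natGenerator w → v = w :=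
    fun v _ w _ h ↦ natGenerator_injective_rat'' h
  have hm' : m = ∏ ℓ ∈ S₀.image Rat.HeightOneSpectrum.natGenerator, ℓ := by
    rw [hm, Finset.prod_image hinj]
  have hG₁ := iwasawaToPowerSeries_prod_tameEulerFactor_mul_mult hf.1 hf.coeffField_eq_bot hpN hap rfl hαu
    (a := W.frobeniusTrace) (teich := teich) (c := fun ℓ : ℕ ↦ frobeniusExponent 2 (ℓ : ℤ_[2])) hS ha hc hm' hLW
  set uv : HeightOneSpectrum (𝓞 ℚ) → (IwasawaAlgebra 2)ˣ := fun v ↦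
    (isUnit_neg_binomialSeries' (-frobeniusExponent 2 (Rat.HeightOneSpectrum.natGenerator v : ℤ_[2]))).unit with huv
  have huv_val : ∀ v, ((uv v : (IwasawaAlgebra 2)ˣ) : IwasawaAlgebra 2) =
      -PowerSeries.binomialSeries ℤ_[2] (-frobeniusExponent 2 (Rat.HeightOneSpectrum.natGenerator v : ℤ_[2])) :=
    fun v ↦ IsUnit.unit_spec _
  have key : ∀ v ∈ S₀, PowerSeries.map (PadicInt.toZMod (p := 2))
      (C ((W.frobeniusTrace (Rat.HeightOneSpectrum.natGenerator v) : ℤ) : ℤ_[2]) -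
        PowerSeries.binomialSeries ℤ_[2] (-frobeniusExponent 2 (Rat.HeightOneSpectrum.natGenerator v : ℤ_[2])) -
        PowerSeries.binomialSeries ℤ_[2] (frobeniusExponent 2 (Rat.HeightOneSpectrum.natGenerator v : ℤ_[2]))) =
      PowerSeries.map (PadicInt.toZMod (p := 2)) ((uv v : IwasawaAlgebra 2) * eulerFactorElement W 2 v) := by
    intro v hv
    have hE := map_toZMod_eulerFactorElement_two_eq W v (hgood v hv) (hcop v hv)
    rw [frobeniusTraceAt_eq_frobeniusTrace] at hE
    rw [map_mul, hE, ← map_mul, huv_val, frobeniusSeries_eq, ← mul_assoc, neg_mul_neg,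
      ← PowerSeries.binomialSeries_add, neg_add_cancel, PowerSeries.binomialSeries_zero, one_mul]
    rfl
  refine ⟨LW, _, ∏ v ∈ S₀, uv v, hLW, hG₁, ?_⟩
  rw [Finset.prod_image hinj, map_mul, map_prod, Finset.prod_congr rfl key, Units.coe_prod, eulerFactorProduct_eq,
    map_mul, map_mul, map_prod, map_prod]
  simp only [map_mul]
  rw [Finset.prod_mul_distrib]
  ring

/-- **The `χ`-twisted one-term tame `2`-adic `L`-function vs `L₂(E)·∏ 𝒫_ℓ`, modulo `2`, at a MULTIPLICATIVE `2`** — the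
character half (`exists_iwasawa_pair_map_toZMod_eq_two_mult`, Lemma 3.2) and the depletion half (§1, Lemma 3.3) combined through
`iwasawaToPowerSeries_injective`: for `E = W/ℚ` globally minimal, multiplicative at `2`, `f` its newform, `S₀` a finite set of odd
places of good reduction, `m = ∏_{v∈S₀} ℓ_v`, `χ` an EVEN QUADRATIC `ℚ₂`-valued character mod `m`: there are `L_W, G ∈ ℤ₂⟦T⟧`,
`u ∈ ℤ₂⟦T⟧ˣ` with `ι L_W = L₂(f,a₂,𝟙_1)`, `ι G = L₂(f,a₂,χ)` and `G ≡ u·L_W·∏_{v∈S₀}𝒫_v (mod 2)`.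
[cite: Matsuno2000, Lemmas 3.2–3.3 and proof of Theorem 3.1 (pp. 87–88)] -/
theorem exists_iwasawa_padicLFunctionTameMult_congr_two (hf : IsNewformOf W f)
    (hmult : W.HasMultiplicativeReductionAtPrime 2) {ap : ℤ} (hap : cuspCoeff f 2 = ap)
    (S₀ : Finset (HeightOneSpectrum (𝓞 ℚ)))
    (hS2 : ∀ v ∈ S₀, Rat.HeightOneSpectrum.natGenerator v ≠ 2) (hgood : ∀ v ∈ S₀, W.HasGoodReductionAt v)
    {m : ℕ} [NeZero m] (hm : m = ∏ v ∈ S₀, Rat.HeightOneSpectrum.natGenerator v)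
    (χ : DirichletCharacter ℚ_[2] m) (hχ : χ.Even) (hsq : χ ^ 2 = 1) :
    ∃ (LW G : IwasawaAlgebra 2) (u : (IwasawaAlgebra 2)ˣ),
      iwasawaToPowerSeries 2 LW = padicLFunctionTameMult f 1 (ap : ℚ_[2]) (1 : DirichletCharacter ℚ_[2] 1) ∧
      iwasawaToPowerSeries 2 G = padicLFunctionTameMult f m (ap : ℚ_[2]) χ ∧
      PowerSeries.map (PadicInt.toZMod (p := 2)) G =
        PowerSeries.map (PadicInt.toZMod (p := 2)) ((u : IwasawaAlgebra 2) * LW * eulerFactorProduct W 2 S₀) := by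
  have hprime : ∀ v : HeightOneSpectrum (𝓞 ℚ), (Rat.HeightOneSpectrum.natGenerator v).Prime := fun v ↦
    (Rat.HeightOneSpectrum.primesEquiv v).2
  have hm2 : m.Coprime 2 := by
    rw [hm]
    exact Nat.Coprime.prod_left fun v hv ↦ (Nat.coprime_primes (hprime v) Nat.prime_two).mpr (hS2 v hv)
  have hmN : m.Coprime N := by
    rw [hm]
    refine Nat.Coprime.prod_left fun v hv ↦ ?_
    haveI : Fact (Rat.HeightOneSpectrum.natGenerator v).Prime := ⟨hprime v⟩
    have hgp : W.HasGoodReductionAtPrime (Rat.HeightOneSpectrum.natGenerator v) :=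
      (hasGoodReductionAtPrime_iff_hasGoodReductionAt_ringOfIntegers v W).mpr (hgood v hv)
    exact (Nat.Prime.coprime_iff_not_dvd (hprime v)).mpr (not_dvd_level_of_isNewformOf hf hgp)
  obtain ⟨G, G₁, hG, hG₁, hGG₁⟩ := exists_iwasawa_pair_map_toZMod_eq_two_mult hf hmult hm2 hmN hap χ hχ hsq
  obtain ⟨LW, G₁', u, hLW, hG₁', hcongr⟩ :=
    exists_iwasawa_padicLFunctionTameMult_one_congr_two hf hmult hap S₀ hS2 hgood hm
  have hEq : G₁ = G₁' := iwasawaToPowerSeries_injective 2 (hG₁.trans hG₁'.symm)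
  exact ⟨LW, G, u, hLW, hG, by rw [hGG₁, hEq, hcongr]⟩

end DepletionAtTwo

/-! ### §3. The mod-`2` twist congruence at a MULTIPLICATIVE `2` -/

section TwoAdic

variable (W : WeierstrassCurve ℚ) [W.IsElliptic] [W.IsGloballyMinimal] {d : ℤ} {A : WeierstrassCurve ℚ}
  [A.IsElliptic] [NeZero (W.conductorNorm ℤ)] [NeZero (A.conductorNorm ℤ)]
  {fW : CuspForm (Gamma0 (W.conductorNorm ℤ)) 2} {fA : CuspForm (Gamma0 (A.conductorNorm ℤ)) 2}

/-- **The mod-`2` twist congruence at a MULTIPLICATIVE `2`** (Matsuno 2000, proof of Thm. 3.1 = Lemmas 3.2 + 3.3, READ AT `p = 2`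
for `E` multiplicative at `2`, with Birch's lemma): for `E = W/ℚ` globally minimal, multiplicative at `2` (either sign; `a₂(E) = a₂`),
`d > 0`, `d ≡ 1 (mod 4)` squarefree and prime to `N_E`, `A` a model of `E^{(d)}` (newforms `f_W`, `f_A`; `a₂(f_A) = (2/d)·a₂`), and
`S₀` the set of places over the primes dividing `d`: there are `L_W, L_A' ∈ Λ = ℤ₂⟦T⟧`, `c_A ∈ ℚˣ` and `v ∈ Λˣ` with
`ι L_W = L₂(f_W, a₂, 𝟙_1)` (THE package function of `E` at `2`), `ι L_A' = C(c_A)·L₂(f_A, (2/d)·a₂, 𝟙_1)` (a rational multiple of THE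
package function of the twist), `L_A' ≡ v · L_W · ∏_{v∈S₀} 𝒫_v (mod 2Λ)`, AND the period size of the constant,
`d · (Ω⁺_{f_A})² = c_A² · (Ω⁺_{f_W})²` (Birch's `c·Ω⁺_{f_A}·g(χ_d) = Ω⁺_{f_W}` squared, `g² = d`; `c_A = c⁻¹`). Birch's constant is
nonzero because `f_A` has a nonzero plus symbol (`exists_ratPlusSymbol_ne_zero`).
[cite: Matsuno2000, Lemmas 3.2–3.3 and proof of Theorem 3.1 (pp. 86–88)] [cite: MazurTateTeitelbaum1986Invent, §I.8 and §I.10 (ε(p) = 0)] -/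
theorem exists_iwasawa_twist_congr_two_mult (hmod : exists_isNewformOf) (hd : 0 < d) (hd4 : d % 4 = 1)
    (hsq : Squarefree d) (hcop : IsCoprime d (W.conductorNorm ℤ : ℤ)) {C : VariableChange ℚ}
    (hA : C • W.quadraticTwist (d : ℚ) = A) (hfW : IsNewformOf W fW) (hfA : IsNewformOf A fA)
    (hmult : W.HasMultiplicativeReductionAtPrime 2) {ap : ℤ} (hap : cuspCoeff fW 2 = ap)
    (S₀ : Finset (HeightOneSpectrum (𝓞 ℚ)))
    (hS₀ : S₀.image Rat.HeightOneSpectrum.natGenerator = d.natAbs.primeFactors) :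
    ∃ (LW LA' : IwasawaAlgebra 2) (cA : ℚ) (v : (IwasawaAlgebra 2)ˣ),
      iwasawaToPowerSeries 2 LW = padicLFunctionTameMult fW 1 (ap : ℚ_[2]) (1 : DirichletCharacter ℚ_[2] 1) ∧ cA ≠ 0 ∧
      iwasawaToPowerSeries 2 LA' = PowerSeries.C (cA : ℚ_[2]) *
        padicLFunctionTameMult fA 1 ((J((2 : ℤ) | d.natAbs) * ap : ℤ) : ℚ_[2]) (1 : DirichletCharacter ℚ_[2] 1) ∧
      PowerSeries.map (PadicInt.toZMod (p := 2)) LA' =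
        PowerSeries.map (PadicInt.toZMod (p := 2)) ((v : IwasawaAlgebra 2) * LW * eulerFactorProduct W 2 S₀) ∧
      (d : ℝ) * plusPeriod fA ^ 2 = (cA : ℝ) ^ 2 * plusPeriod fW ^ 2 := by
  haveI : Fact (Nat.Prime 2) := ⟨Nat.prime_two⟩
  have hd0 : d ≠ 0 := hd.ne'
  haveI : NeZero d.natAbs := ⟨Int.natAbs_ne_zero.mpr hd0⟩
  have hsq' : Squarefree d.natAbs := Int.squarefree_natAbs.mpr hsq
  have hm4 : d.natAbs % 4 = 1 := by omega
  have hd2 : ¬ (2 : ℤ) ∣ d := by omega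
  have hpm : ¬ 2 ∣ d.natAbs := fun h ↦ hd2 (Int.natCast_dvd.mpr h)
  have hmp : d.natAbs.Coprime 2 := Nat.coprime_comm.mp ((Nat.Prime.coprime_iff_not_dvd Nat.prime_two).mpr hpm)
  obtain ⟨hpN, hαu⟩ := two_dvd_and_norm_eq_one_of_mult hfW hmult hap
  obtain ⟨χ, hχ⟩ := exists_mulChar_int_eq_jacobiSym d.natAbs
  -- Birch at the symbol level, its nonzero constant and the period identity
  obtain ⟨c, hB, hper⟩ := exists_ratPlusSymbol_twist_eq_sum_and_sq W hmod hd hd4 hsq hcop hA hfW hfA hχ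
  have hxA : ∃ x : ℚ, ratPlusSymbol fA x ≠ 0 := exists_ratPlusSymbol_ne_zero hfA.1 hfA.coeffField_eq_bot
  have hc0 : c ≠ 0 := by
    rintro rfl
    obtain ⟨x, hx⟩ := hxA
    exact hx (by rw [hB x, zero_mul])
  have hperiod : (d : ℝ) * plusPeriod fA ^ 2 = ((c⁻¹ : ℚ) : ℝ) ^ 2 * plusPeriod fW ^ 2 := by
    have h := hper hxA
    have hcR : (c : ℝ) ≠ 0 := by exact_mod_cast hc0
    rw [← h]
    push_cast
    field_simp
  -- Birch for the one-term transforms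
  have hχp : (χ.ringHomComp (Int.castRingHom ℚ)) ((2 : ℕ) : ZMod d.natAbs) ^ 2 = 1 := by
    rw [MulChar.ringHomComp_apply, ← map_pow, mulChar_jacobi_apply_natCast_sq hχ 2 hmp.symm, map_one]
  have key := padicLFunctionTameMult_twist_eq_of_birch fW fA hfW.1 hfW.coeffField_eq_bot hpN hmp hap rfl hαu
    (χ.ringHomComp (Int.castRingHom ℚ)) hχp hB
  have hαA : (((χ.ringHomComp (Int.castRingHom ℚ)) ((2 : ℕ) : ZMod d.natAbs) : ℚ) : ℚ_[2]) * ((ap : ℤ) : ℚ_[2]) =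
      (((J((2 : ℤ) | d.natAbs) * ap : ℤ)) : ℚ_[2]) := by
    rw [MulChar.ringHomComp_apply, mulChar_jacobi_apply_natCast hχ 2, eq_intCast]
    push_cast
    ring
  rw [hαA] at key
  -- the character `χ₂` and the tame congruence at `2`
  set χ₂ : DirichletCharacter ℚ_[2] d.natAbs :=
    (χ.ringHomComp (Int.castRingHom ℚ)).ringHomComp (Rat.castHom ℚ_[2]) with hχ₂_def
  have hχ₂even : χ₂.Even := by
    show χ₂ (-1) = 1
    rw [hχ₂_def, MulChar.ringHomComp_apply, MulChar.ringHomComp_apply, mulChar_jacobi_apply_neg_one hχ hm4, map_one,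
      map_one]
  have hχ₂sq : χ₂ ^ 2 = 1 := by
    have : χ₂ = χ.ringHomComp ((Rat.castHom ℚ_[2]).comp (Int.castRingHom ℚ)) := MulChar.ext' fun a ↦ rfl
    rw [this]
    exact mulChar_jacobi_ringHomComp_sq hχ _
  have hS2 : ∀ v ∈ S₀, Rat.HeightOneSpectrum.natGenerator v ≠ 2 := by
    intro v hv h
    have hmem : Rat.HeightOneSpectrum.natGenerator v ∈ d.natAbs.primeFactors := hS₀ ▸ Finset.mem_image_of_mem _ hv
    rw [h] at hmem
    exact hd2 (Int.natCast_dvd.mpr (Nat.dvd_of_mem_primeFactors hmem))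
  have hgood : ∀ v ∈ S₀, W.HasGoodReductionAt v := by
    intro v hv
    refine hasGoodReductionAt_of_not_dvd_conductorNorm W v fun hvN ↦ ?_
    have hmem : Rat.HeightOneSpectrum.natGenerator v ∈ d.natAbs.primeFactors := hS₀ ▸ Finset.mem_image_of_mem _ hv
    have hℓ : (Rat.HeightOneSpectrum.natGenerator v).Prime := Nat.prime_of_mem_primeFactors hmem
    have hℓd : (Rat.HeightOneSpectrum.natGenerator v : ℤ) ∣ d := Int.natCast_dvd.mpr (Nat.dvd_of_mem_primeFactors hmem)
    have hu := Int.isUnit_iff_natAbs_eq.mp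
      (hcop.isUnit_of_dvd' hℓd (Int.natCast_dvd_natCast.mpr hvN))
    rw [Int.natAbs_natCast] at hu
    exact hℓ.one_lt.ne' hu
  have hm : d.natAbs = ∏ v ∈ S₀, Rat.HeightOneSpectrum.natGenerator v := by
    have h := Nat.prod_primeFactors_of_squarefree hsq'
    rw [← hS₀, Finset.prod_image fun v _ w _ h ↦ natGenerator_injective_rat'' h] at h
    exact h.symm
  obtain ⟨LW, G, u, hLW, hG, hGc⟩ :=
    exists_iwasawa_padicLFunctionTameMult_congr_two hfW hmult hap S₀ hS2 hgood hm χ₂ hχ₂even hχ₂sq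
  -- the unit `(1+T)^{−f_m}` of `Λ`
  set B : IwasawaAlgebra 2 := PowerSeries.binomialSeries ℤ_[2] (-frobeniusExponent 2 (d.natAbs : ℤ_[2])) with hBdef
  have hBu : IsUnit B :=
    isUnit_iff_exists_inv.mpr ⟨PowerSeries.binomialSeries ℤ_[2] (frobeniusExponent 2 (d.natAbs : ℤ_[2])), by
      rw [hBdef, ← PowerSeries.binomialSeries_add, neg_add_cancel, PowerSeries.binomialSeries_zero]⟩
  have hcQ : (c : ℚ_[2]) ≠ 0 := by exact_mod_cast hc0
  refine ⟨LW, B * G, c⁻¹, hBu.unit * u, hLW, inv_ne_zero hc0, ?_, ?_, hperiod⟩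
  · rw [map_mul, hG, hBdef, BurungaleSkinner2023.iwasawaToPowerSeries_binomialSeries, key, Rat.cast_inv, ← mul_assoc,
      ← mul_assoc, ← map_mul, inv_mul_cancel₀ hcQ, map_one, one_mul]
  · rw [map_mul, hGc, ← map_mul, Units.val_mul, IsUnit.unit_spec]
    congr 1
    ring

end TwoAdic

end Literature.NumberTheory.EllipticCurves

end
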